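/-
Copyright (c) 2026 the pub-hodgecm-mathlib formalisation cell (harness21).  R90-TF SLAB, section S10 (Rogawski 1990, §13.6–13.8 read at `v`),
prover R90-C138-p07 (g2) — THE S10 KEYSTONE IN THE hadm-FORM OF RECORD (dealer R90-C138-plan (g4) rulings R15 ∕ R15′, 2026-09-05T03:33:34Z ∕ 03:35:40Z, on p02 (g2)'s junction
finding J-hbc-adm); h413 = `stmt-HodgeConjecture-24833`, route `HCCMUnconditional`.
-/
import Summits.HodgeConjecture.HodgeConjecture.Theorems.R90S10StabilisedAtEvp2OfInputs        -- ★ p865101 (this seat) keystone v1: §0 `eq_half_mul_of_tfBlocks` BY NAME (+ every ★ it imports: (P-rig) glue, `cDOf`, pins, C2₂, `StabilisationData`, separation)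
import Summits.HodgeConjecture.HodgeConjecture.Theorems.R90S10GermOfMembersOfBCAdm             -- ★ p865194 DEAL #83 (K2Liu-p13): (P-t₀) `germOfMembersLetter_of_bcSpherical_adm` from the hadm-form `hbc`
import HarnessLib

/-!
# R90-TF ∕ S10 — THE KEYSTONE, hadm-FORM OF RECORD: `Sock₂Sig 𝔣` FROM ITS NAMED INPUTS, WITH THE SPHERICAL-BASE-CHANGE PIN `hbc` STATED FOR ADMISSIBLE CLASSES
# (`Theorems/R90S10StabilisedAtEvp2OfInputsAdm.lean`; ns `Summit.HodgeConjecture.HodgeConjecture.R90.S10`; THEOREMS ONLY — no `def`, no instance, no notation, 0 `sorry`; LAW L9)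

Print: [Rogawski1990] §13.8 display (13.8.3) p. 218 L5–7, L20–L28, p. 219 L2–L3; §13.6 (13.6.1) p. 208, Props. 13.6.1–13.6.2 pp. 209–210, Lemma 13.6.3 p. 210; §13.7 p. 211;
§12.1 p. 171 (admissible duals); §4.9 Prop. 4.9.1 (b) p. 55.  [Langlands1980] pp. 208–211.  [Arthur1988InvariantTraceFormulaII] Thm. 7.1 p. 538.  [CartierCorvallis1979] §IV.1 Cor. 4.1–4.2.

## WHY THIS FILE (dealer RULING R15 = p02 (g2)'s junction finding J-hbc-adm, upheld first-hand)
★ keystone v1 `sock₂Sig_of_inputs` (p865101) binds the pin `hbc` for EVERY irreducible `U(Φ₃)(𝒪_w)`-spherical class lying over `ρ_w`.  Both ★ payers of that pin bind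
ADMISSIBILITY (inert: ★ `unopClassSphericalCharacter_eq_of_liesOver_of_heckeFLAt … (hadm) (hadm₀)`, K2E3-p21 p864959; split: ★ `eq_and_unopClassSphericalCharacter_eq_of_liesOver_frozen_of_split
… (hadm) (hadm₀)`, K2Liu-p13 p864906), «irreducible smooth ⇒ admissible» is not ★, and the pin's one consumer applies it only at MEMBERS' local classes, admissible by ★
`isAdmissible_of_isLinked` — so the binder OF RECORD is the **hadm-form**: `(hadm : πw.IsAdmissible)` inserted immediately after `(πw : IrrClass (Gqs L w.1))`, every other byte as in ★ v1.
This file restates ★ v1's §1–§2 with that one insertion (§0 `eq_half_mul_of_tfBlocks` imported BY NAME; (P-t₀) now by ★ #83 `germOfMembersLetter_of_bcSpherical_adm`) and adds §3, the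
row-6 `t₀`-FREE head.  ★ v1 stays in the tree as the stronger-hypothesis variant (harmless, not on the callback path).

## CONTENTS (all ★-backed; TRIO)
* §1 `stabilisedAtEvp_of_inputs_adm` — ★ v1 §1 (`stabilisedAtEvp_of_inputs`) with the hadm-form `hbc`; body verbatim but `ht₀ := germOfMembersLetter_of_bcSpherical_adm …`.
* §2 **`sock₂Sig_of_inputs_adm`** — THE KEYSTONE OF RECORD for `𝔣 : S10FrozenDatum₂ … CuspG CuspH` keyed on E1's 12R3 `h12`; conclusion = `Sock₂Sig 𝔣` unfolded at `𝔣.toS10FrozenDatum`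
  (junction certificate `example … : Sock₂Sig 𝔣 := sock₂Sig_of_inputs_adm …` against Lines B ED. 3, posted with the REPORT-FIRST).
* §3 **`sock₂Sig_of_inputs_of_liesOver`** — §2 with ROW 6 `t₀`-FREE: the last binder is `hLO` («at every `w ≠ v` SOME admissible `U(Φ₃)(𝒪_w)`-spherical class lies over `ρ_w`» — ★ p01
  `exists_liesOver_frozen_of_letters` with its parameter forgotten, or the level-trace road ★ p865075 from `hPS♭`; supplier of record p01 #88 `hLO_ofRecord`) in place of `hex`; the
  hadm-form pin `hbc` REALIGNS any such class to the named germ `t₀` inside, so `hex` is recovered and §2 applies.  Use §3 when `t₀` is NAMED (S5's `ξ_H`-image), §2 when `t₀` is CHOSEN.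
EXTERNAL BINDERS exactly as ★ v1 (each named for its payer): `hunr` ⟪U⟫, `h12` (12R3), `hD1` (S6), `hθ` (S8 (V-G) at `dG`), `hd` (row 3 at `cDOf`, #82), `hH`, `hH4` (S5), `hbc` (hadm-form;
#84 `hbc_of_hex`), `hex` ∕ `hLO` (#88); PARAMETERS `S hv hS bd σ hσ hRepGerm {TH} 𝔖 ΦHu dG cH t₀` (J-𝔖: `{TH} 𝔖 ΦHu cH` are S6∕S5's shared data, named by their payers).
HONEST LABEL: ★ helper (`--supports stmt-HodgeConjecture-24833 --as helper`); the keystone ASSEMBLES `Sock₂Sig 𝔣` ONLY MODULO its named by-value inputs — it pays no socket by itself;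
`sock_S10_stabilisedAtEvp₂` stays OPEN in Lines B until an edition plugs ★ payers into these binders (J-𝔖 pending at LEAD); HC_CM is proved only modulo the 7 printed citations
(2 remaining named inputs: hLiu418 = `stmt-HodgeConjecture-24832`, h413 = `stmt-HodgeConjecture-24833`) until rung 0 closes; REL ≠ ★ ≠ BUILT.
-/

set_option autoImplicit false
set_option linter.dupNamespace false

noncomputable section

open scoped RestrictedProduct Matrix MatrixGroups ComplexConjugate
open Filter MeasureTheory NumberField IsDedekindDomain CompactlySupported
open Literature.NumberTheory.Rogawski1990 Literature.NumberTheory.Automorphic Literature.NumberTheory.Automorphic.UnitaryGroup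
open Literature.NumberTheory.Automorphic.UnitaryGroup.CotangentForms Literature.NumberTheory.GaloisRepresentations
open Literature.NumberTheory.Automorphic.Arthur2013.Leaves.TECR
open Summit.HodgeConjecture.HodgeConjecture.Cruxes.H413
open Summit.HodgeConjecture.HodgeConjecture.Cruxes.H413.K2E1TraceFormulaBeta
open Summit.HodgeConjecture.HodgeConjecture.Cruxes.H413.K2E1SpectralTermsDiscreteHalf
open Summit.HodgeConjecture.HodgeConjecture.Cruxes.H413.K2E1EvpOfAutomorphicClass
open Summit.HodgeConjecture.HodgeConjecture.Cruxes.H413.K2E1GlobalTestFunctions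
open Summit.HodgeConjecture.HodgeConjecture.Cruxes.H413.F0P3ClassTokenChoice

namespace Summit.HodgeConjecture.HodgeConjecture.R90.S10

section KeystoneAdm

variable {L : Type} [Field L] [NumberField L] [IsCMField L] [DecidableEq (Pl L)] {μ : HeckeCharacter L} {v : Pl L}
  [MeasurableSpace (HLoc L v)] [BorelSpace (HLoc L v)] [MeasurableSpace (Gqs L v)] [BorelSpace (Gqs L v)]
  {νHv : Measure (HLoc L v)} {νQv : Measure (Gqs L v)} [νHv.IsHaarMeasure] [νHv.IsMulRightInvariant] [νQv.IsHaarMeasure] [νQv.IsMulRightInvariant]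
  [∀ a : HLoc L v, MeasurableSpace (HLoc L v ⧸ Subgroup.centralizer ({a} : Set (HLoc L v)))]
  [∀ a : HLoc L v, BorelSpace (HLoc L v ⧸ Subgroup.centralizer ({a} : Set (HLoc L v)))]
  [∀ γ : Gqs L v, MeasurableSpace (Gqs L v ⧸ Subgroup.centralizer ({γ} : Set (Gqs L v)))]
  [∀ γ : Gqs L v, BorelSpace (Gqs L v ⧸ Subgroup.centralizer ({γ} : Set (Gqs L v)))]
  {mHv : OrbitalMeasureFamily (HLoc L v)} {mQv : OrbitalMeasureFamily (Gqs L v)} {πSt : IrrClass (HLoc L v)}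
  [MeasurableSpace (G3 L).Adelic] [BorelSpace (G3 L).Adelic] [MeasurableSpace (H2 L).Adelic] [BorelSpace (H2 L).Adelic]
  [MeasurableSpace (GArch L)] [BorelSpace (GArch L)] [MeasurableSpace (HArch L)] [BorelSpace (HArch L)]
  [MeasurableSpace (H1Loc L v)] [MeasurableSpace (H1Arch L)] [MeasurableSpace (H1 L).Adelic] [BorelSpace (H1 L).Adelic]
  {CuspG : ArchOrbFamG L → (L →+* ℂ) → (GArch L → ℂ) → Prop} {CuspH : ArchOrbFamH L → (L →+* ℂ) → (HArch L → ℂ) → Prop}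

/-! ## §1 (hadm-form) The core: (D1)–(D4) ⟹ the stabilised identity at `t₀`, at an ED. 1 frozen datum and FILE D's germs `EvpGerm S (HeckeQs L) bd σ` -/

/-- **THE STABILISED IDENTITY AT THE E.V.P. `t₀` FROM ITS NAMED INPUTS (CORE, ED. 1 frozen datum `𝔣'`).**  Data: a level `S` with `v ∈ S ⊆ {v}`, FILE D's twin's germs
`EvpGerm S (HeckeQs L) bd σ` = `{t // (∀ i x, ‖t i x‖ ≤ bd i x) ∧ ∀ i x, t i (σ i x) = conj (t i x)}` (bounded, star-fixed e.v.p.'s of UNITARY classes, §10.3 p. 159; the five Langlands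
pins are DISCHARGED by ★ `unrHatPins_of_restricted S (HeckeQs L) bd σ hσ`) containing every germ of record (`hRepGerm`; at the pins of record ★ `germOfDiscreteClass_mem_germSub`),
the stabilisation carrier `𝔖` (its `θ_G` on ★ `GlobalTestFunction`s, `SΘ_H` on `TH`), the frozen `H`-family `ΦHu`, the discrete part `dG`, the `H`-coefficients `cH`, the germ `t₀`.
Hypotheses (FILE D's block BODIES, verbatim at the twin's instantiation `Unr := UnrQs L S`, `ΦGu := 𝔣'.𝔳.ΦGu S`, `hat t f := t.1.hat f.1`, `cD := cDOf 𝔣' S evp` ★ (typ2's (D8-1), K2Liu-p13's DEAL #50) at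
`evp c := ⟨germOfDiscreteClass S c, hRepGerm c⟩` — D ED. 5's `hd` token (D8-3)): (D1)₂ `hD1` — `θ_G(ΦGu u φ) − ½ · SΘ_H(ΦHu u f^H_v) = 0` on matched pairs [p. 218 L20–L21; §10.3]; `hθ` — `θ_G` IS the discrete
part `dG` on the family (+ the pinned-zero continuous term, D's `ThetaGPinnedHyp … dG 0` token) [(13.6.1), Arthur Thm. 7.1]; (D2-d) `hd` — the discrete part expands in germs with the
coefficient of record [(13.6.1), §13.7]; (D2-H) `hH` — `SΘ_H` expands in germs [Prop. 13.6.1]; (D4-H) `hH4` — the `H`-coefficient at `t₀` is the packet trace `Σᶠ_j m(ρ_j) Tr ρ_j(𝔳.ΦH f^H_v)`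
[Lemma 13.6.3 (a)(b)]; and for (D4-d): ⟪U⟫ `hunr`, «AFA» `hAF`, the LOCAL inputs `hbc` (hadm-form; (P-t₀), ★ `germOfMembersLetter_of_bcSpherical_adm`) and `hex` ((P-rig), ★
`rigidityAtGermLetter_subtype_of_exists_liesOver`), through ★ W1-H2′.  CONCLUSION: Lines C's `StabilisedAtEvpHyp` body at `mOf 𝔣'`, `trGPinned 𝔣'`, `trHPinned 𝔣'` unfolded —
`Σᶠ_i m(π_i) · Tr [P i](𝔳.ΦG φ) = ½ · Σᶠ_j m(ρ_j) · Tr ρ_j(𝔳.ΦH f^H_v)` (= Lines B's ONE-PLACE socket B1 `sock_S10_stabilisedAtEvp 𝔣'`'s body as well).  PROOF = D's `stabilisedAtEvp_of_tfBlocks₂`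
inline: the germ series of `θ_G − ½ SΘ_H` with coefficients `cD_t(φ) − ½ cH_t(f^H_v)` sums to `0` for every unramified test ((D1)₂ + `hθ` + (D2)), Langlands separation (★
`separation_of_injective_bounded_starClosed` on the five ★ pins) kills the coefficient at `t₀`, and the two readings (D4-d) (D4-H) give the identity.
[cite: Rogawski1990, §13.8 display (13.8.3) p. 218 L5–7, L20–L28, p. 219 L2–L3; §13.6 (13.6.1) p. 208, Props. 13.6.1–13.6.2 pp. 209–210, Lemma 13.6.3 p. 210; §13.7 p. 211; §10.3 p. 159]
[cite: Langlands1980, pp. 208–211] [cite: Arthur1988InvariantTraceFormulaII, Thm. 7.1 p. 538] [cite: FlathCorvallis1979, Thm. 3] -/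
theorem stabilisedAtEvp_of_inputs_adm
    (hunr : ∀ w : Pl L, w ≠ v → ∀ W : PlacesOver L w, Algebra.IsUnramifiedAt (𝓞 ↥(maximalRealSubfield L)) W.1.asIdeal ∧ μ.IsUnramifiedAt W.1)
    (𝔣' : S10FrozenDatum L μ v νHv νQv mHv mQv πSt)
    (hAF : haveI := 𝔣'.𝔤.hμG; AutomorphicFlathAdmissible (↥(maximalRealSubfield L)) L (IsCMField.complexConj L) 3 (qsForm L) 𝔣'.𝔤.μG)
    (S : Set (Pl L)) (hv : v ∈ S) (hS : ∀ w, w ∈ S → w = v)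
    (bd : ∀ i : {i : Pl L // i ∉ S}, HeckeQs L i.1 → ℝ) (σ : ∀ i : {i : Pl L // i ∉ S}, HeckeQs L i.1 → HeckeQs L i.1) (hσ : ∀ i, σ i 1 = 1)
    (hRepGerm : haveI := 𝔣'.𝔤.hμG; ∀ c : DiscreteClass (G3 L) 𝔣'.𝔤.μG,
      (∀ i x, ‖germOfDiscreteClass S c i x‖ ≤ bd i x) ∧ ∀ i x, germOfDiscreteClass S c i (σ i x) = (starRingEnd ℂ) (germOfDiscreteClass S c i x))
    {TH : Type*} (𝔖 : StabilisationData (GlobalTestFunction L 3 (qsForm L)) TH) (ΦHu : UnrQs L S → (HLoc L v → ℂ) → TH)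
    (dG : GlobalTestFunction L 3 (qsForm L) → ℂ) (cH : {t : Ch13Sec6.EigenvaluePackage S (HeckeQs L) // (∀ i x, ‖t i x‖ ≤ bd i x) ∧ ∀ i x, t i (σ i x) = (starRingEnd ℂ) (t i x)} → (HLoc L v → ℂ) → ℂ)
    (t₀ : {t : Ch13Sec6.EigenvaluePackage S (HeckeQs L) // (∀ i x, ‖t i x‖ ≤ bd i x) ∧ ∀ i x, t i (σ i x) = (starRingEnd ℂ) (t i x)})
    -- (D1)₂ two-place stabilised vanishing on the frozen family (S6)
    (hD1 : ∀ (u : UnrQs L S) (fH : HLoc L v → ℂ) (φ : Gqs L v → ℂ), MatchE1 L μ v mHv mQv fH φ →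
      𝔖.θG (𝔣'.𝔳.ΦGu S u φ) - (1 / 2 : ℂ) * 𝔖.SθH (ΦHu u fH) = 0)
    -- `θ_G` is its discrete part on the family (S8 (V-G)), continuous term pinned to `0`
    (hθ : ∀ (u : UnrQs L S) (φ : Gqs L v → ℂ), 𝔖.θG (𝔣'.𝔳.ΦGu S u φ) = dG (𝔣'.𝔳.ΦGu S u φ) + (0 : GlobalTestFunction L 3 (qsForm L) → ℂ) (𝔣'.𝔳.ΦGu S u φ))
    -- (D2-d) the discrete germ expansion at the germ coefficient OF RECORD (row 3)
    (hd : haveI := 𝔣'.𝔤.hμG; haveI := 𝔣'.𝔤.hνG; ∀ (u : UnrQs L S) (fH : HLoc L v → ℂ) (φ : Gqs L v → ℂ), MatchE1 L μ v mHv mQv fH φ →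
      (Summable fun t : {t : Ch13Sec6.EigenvaluePackage S (HeckeQs L) // (∀ i x, ‖t i x‖ ≤ bd i x) ∧ ∀ i x, t i (σ i x) = (starRingEnd ℂ) (t i x)} =>
        cDOf 𝔣' S (fun c => (⟨germOfDiscreteClass S c, hRepGerm c⟩ : {t : Ch13Sec6.EigenvaluePackage S (HeckeQs L) // (∀ i x, ‖t i x‖ ≤ bd i x) ∧ ∀ i x, t i (σ i x) = (starRingEnd ℂ) (t i x)})) t φ * t.1.hat u.1) ∧
      dG (𝔣'.𝔳.ΦGu S u φ) = ∑' t : {t : Ch13Sec6.EigenvaluePackage S (HeckeQs L) // (∀ i x, ‖t i x‖ ≤ bd i x) ∧ ∀ i x, t i (σ i x) = (starRingEnd ℂ) (t i x)},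
        cDOf 𝔣' S (fun c => (⟨germOfDiscreteClass S c, hRepGerm c⟩ : {t : Ch13Sec6.EigenvaluePackage S (HeckeQs L) // (∀ i x, ‖t i x‖ ≤ bd i x) ∧ ∀ i x, t i (σ i x) = (starRingEnd ℂ) (t i x)})) t φ * t.1.hat u.1)
    -- (D2-H) the germ expansion of `SΘ_H` on the frozen `H`-family (S5)
    (hH : ∀ (u : UnrQs L S) (fH : HLoc L v → ℂ) (φ : Gqs L v → ℂ), MatchE1 L μ v mHv mQv fH φ →
      (Summable fun t : {t : Ch13Sec6.EigenvaluePackage S (HeckeQs L) // (∀ i x, ‖t i x‖ ≤ bd i x) ∧ ∀ i x, t i (σ i x) = (starRingEnd ℂ) (t i x)} => cH t fH * t.1.hat u.1) ∧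
      𝔖.SθH (ΦHu u fH) = ∑' t : {t : Ch13Sec6.EigenvaluePackage S (HeckeQs L) // (∀ i x, ‖t i x‖ ≤ bd i x) ∧ ∀ i x, t i (σ i x) = (starRingEnd ℂ) (t i x)}, cH t fH * t.1.hat u.1)
    -- (D4-H) the `H`-coefficient at `t₀` is the packet trace (S5)
    (hH4 : haveI := 𝔣'.𝔥.hμH; haveI := 𝔣'.𝔥.hνH; ∀ (fH : HLoc L v → ℂ) (φ : Gqs L v → ℂ), MatchE1 L μ v mHv mQv fH φ →
      cH t₀ fH = ∑ᶠ j, (((𝔣'.𝔥.dρ j).mult).toNat : ℂ) * (𝔣'.𝔥.dρ j).classTrace 𝔣'.𝔥.νH (𝔣'.𝔳.ΦH fH))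
    -- (P-t₀)'s local input, hadm-FORM (J-hbc-adm): every ADMISSIBLE `U(Φ₃)(𝒪_w)`-spherical class lying over `ρ_w` has character `(t₀)_w` (#83's `hbc`)
    (hbc : ∀ (w : {w : Pl L // w ≠ v}) (hwS : w.1 ∉ S) (πw : IrrClass (Gqs L w.1)) (hadm : πw.IsAdmissible) (hsph : πw.IsSpherical (cmLocalIntegralLevel L 3 (qsForm L) w.1)),
      LiesOver L μ w.1 (𝔣'.𝔳.K w.1) (𝔣'.𝔥.KH w.1) (𝔣'.𝔳.νQ w) (𝔣'.𝔳.νHw w) (𝔣'.𝔳.mH w) (𝔣'.𝔳.mQ w) πw (𝔣'.𝔥.ρ w.1) →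
        unopClassSphericalCharacter (cmLocalIntegralLevel L 3 (qsForm L) w.1) πw hsph = t₀.1 ⟨w.1, hwS⟩)
    -- (P-rig)'s local input: the ∃-form «`ξ_H(ρ_w)` exists with character `(t₀)_w`» (#26's `hex`)
    (hex : ∀ (w : {w : Pl L // w ≠ v}) (hwS : w.1 ∉ S), ∃ π₀ : IrrClass (Gqs L w.1), π₀.IsAdmissible ∧ ∃ h₀ : π₀.IsSpherical (cmLocalIntegralLevel L 3 (qsForm L) w.1),
      unopClassSphericalCharacter (cmLocalIntegralLevel L 3 (qsForm L) w.1) π₀ h₀ = t₀.1 ⟨w.1, hwS⟩ ∧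
        LiesOver L μ w.1 (𝔣'.𝔳.K w.1) (𝔣'.𝔥.KH w.1) (𝔣'.𝔳.νQ w) (𝔣'.𝔳.νHw w) (𝔣'.𝔳.mH w) (𝔣'.𝔳.mQ w) π₀ (𝔣'.𝔥.ρ w.1)) :
    haveI := 𝔣'.𝔤.hμG
    haveI := 𝔣'.𝔤.hνG
    haveI := 𝔣'.𝔥.hμH
    haveI := 𝔣'.𝔥.hνH
    ∀ (fH : HLoc L v → ℂ) (φ : Gqs L v → ℂ), MatchE1 L μ v mHv mQv fH φ →
      ∑ᶠ i : 𝔣'.𝔤.ι, ((((DiscreteClass.mk (𝔣'.𝔤.P i)).mult).toNat : ℕ) : ℂ) * (DiscreteClass.mk (𝔣'.𝔤.P i)).classTrace 𝔣'.𝔤.νG (𝔣'.𝔳.ΦG φ) =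
        (1 / 2 : ℂ) * ∑ᶠ j, (((𝔣'.𝔥.dρ j).mult).toNat : ℂ) * (𝔣'.𝔥.dρ j).classTrace 𝔣'.𝔥.νH (𝔣'.𝔳.ΦH fH) := by
  haveI := 𝔣'.𝔤.hμG
  haveI := 𝔣'.𝔤.hνG
  haveI := 𝔣'.𝔥.hμH
  haveI := 𝔣'.𝔥.hνH
  -- the two e.v.p. pins at the germ map of record, then (D4-d) by ★ W1-H2′
  have ht₀ : GermOfMembersLetter 𝔣' (fun c => (⟨germOfDiscreteClass S c, hRepGerm c⟩ : {t : Ch13Sec6.EigenvaluePackage S (HeckeQs L) // (∀ i x, ‖t i x‖ ≤ bd i x) ∧ ∀ i x, t i (σ i x) = (starRingEnd ℂ) (t i x)})) t₀ :=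
    germOfMembersLetter_of_bcSpherical_adm L μ v νHv νQv mHv mQv πSt 𝔣' S hv hRepGerm t₀ hbc
  have hrig : RigidityAtGermLetter 𝔣' (fun c => (⟨germOfDiscreteClass S c, hRepGerm c⟩ : {t : Ch13Sec6.EigenvaluePackage S (HeckeQs L) // (∀ i x, ‖t i x‖ ≤ bd i x) ∧ ∀ i x, t i (σ i x) = (starRingEnd ℂ) (t i x)})) t₀ :=
    rigidityAtGermLetter_subtype_of_exists_liesOver hunr 𝔣' hAF S hv hS hRepGerm t₀ hex
  -- (D4-d) at the coefficient of record `cDOf` (★ W1-H2′; `cDOf` unfolds to its left side by `rfl`)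
  have hd4 : ∀ (fH : HLoc L v → ℂ) (φ : Gqs L v → ℂ), MatchE1 L μ v mHv mQv fH φ →
      cDOf 𝔣' S (fun c => (⟨germOfDiscreteClass S c, hRepGerm c⟩ : {t : Ch13Sec6.EigenvaluePackage S (HeckeQs L) // (∀ i x, ‖t i x‖ ≤ bd i x) ∧ ∀ i x, t i (σ i x) = (starRingEnd ℂ) (t i x)})) t₀ φ =
        ∑ᶠ i : 𝔣'.𝔤.ι, (((DiscreteClass.mk (𝔣'.𝔤.P i)).mult).toNat : ℂ) * (DiscreteClass.mk (𝔣'.𝔤.P i)).classTrace 𝔣'.𝔤.νG (𝔣'.𝔳.ΦG φ) :=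
    discreteCoeffAtT0_frozenFamily_unrUnit_of_letters 𝔣' S t₀ _ ht₀ hrig
  intro fH φ hM
  obtain ⟨hinj, hbdd, hmul, hstar, hone⟩ := unrHatPins_of_restricted S (HeckeQs L) bd σ hσ
  -- §0 at this matched pair, as functions of the unramified test `u` (the four block inputs are fed as GOALS: inline lambdas make the elaborator unify against
  -- not-yet-instantiated binder types and unfold `Summable`∕`tsum` — measured; goal-by-goal `exact` is instant)
  refine eq_half_mul_of_tfBlocks (fun t f => t.1.hat f.1) hinj hbdd hmul hstar hone
    (fun u => 𝔖.θG (𝔣'.𝔳.ΦGu S u φ)) (fun u => dG (𝔣'.𝔳.ΦGu S u φ)) (fun u => 𝔖.SθH (ΦHu u fH))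
    (fun t => cDOf 𝔣' S (fun c => (⟨germOfDiscreteClass S c, hRepGerm c⟩ : {t : Ch13Sec6.EigenvaluePackage S (HeckeQs L) // (∀ i x, ‖t i x‖ ≤ bd i x) ∧ ∀ i x, t i (σ i x) = (starRingEnd ℂ) (t i x)})) t φ) (fun t => cH t fH) t₀
    ?_ ?_ ?_ ?_ (hd4 fH φ hM) (hH4 fH φ hM)
  · intro u; exact hD1 u fH φ hM
  · intro u; exact (hθ u φ).trans (add_zero _)
  · intro u; exact hd u fH φ hM
  · intro u; exact hH u fH φ hM

/-! ## §2 (hadm-form) The keystone for a two-place frozen datum at FILE D's germs `EvpGerm S (HeckeQs L) bd σ` (pins discharged) -/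

/-- **THE S10 KEYSTONE — `Sock₂Sig 𝔣` FROM ITS NAMED INPUTS** for a two-place frozen datum `𝔣 : S10FrozenDatum₂ …` (any cusp-pin instance `CuspG CuspH`; the socket of record has
S2's `CuspG₀ ∕ CuspH₀`), at FILE D's twin's germs `EvpGerm S (HeckeQs L) bd σ`, the fin-component head keyed on E1's 12R3 `h12 : CmResidualSpectrumCompactR L 3 𝔣.𝔤.μG` («AFA» by ★
`R90.S5.automorphicFlathAdmissible_qs_of_residualCompactR`).  Conclusion = Lines B's `Sock₂Sig 𝔣` unfolded at the
projection `𝔣.toS10FrozenDatum` (defeq through `sock₂Sig_iff`, `StabilisedAtEvpHyp`, `mOf`, `trGPinned`, `trHPinned`, `classTraceAt`, `weightedCutSum` — plain `def`s), so Lines B ED. 4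
pays `sock_S10_stabilisedAtEvp₂ 𝔣 := sock₂Sig_of_inputs_adm 𝔣 …` by `exact` once every binder has a ★ payer.  Binders = §1's at `𝔣' := 𝔣.toS10FrozenDatum`.
[cite: Rogawski1990, §13.8 display (13.8.3) p. 218 L5–7, L20–L28, p. 219 L2–L3; §13.6 (13.6.1) p. 208, Props. 13.6.1–13.6.2 pp. 209–210, Lemma 13.6.3 p. 210; §13.7 p. 211; §10.3 p. 159]
[cite: Langlands1980, pp. 208–211] [cite: Arthur1988InvariantTraceFormulaII, Thm. 7.1 p. 538] [cite: FlathCorvallis1979, Thm. 3] -/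
theorem sock₂Sig_of_inputs_adm
    (hunr : ∀ w : Pl L, w ≠ v → ∀ W : PlacesOver L w, Algebra.IsUnramifiedAt (𝓞 ↥(maximalRealSubfield L)) W.1.asIdeal ∧ μ.IsUnramifiedAt W.1)
    (𝔣 : S10FrozenDatum₂ L μ v νHv νQv mHv mQv πSt CuspG CuspH)
    (h12 : @K2E1CuspidalSpectrumUnitary.CmResidualSpectrumCompactR L _ _ _ 3 𝔣.toS10FrozenDatum.𝔤.μG 𝔣.toS10FrozenDatum.𝔤.hμG)
    (S : Set (Pl L)) (hv : v ∈ S) (hS : ∀ w, w ∈ S → w = v)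
    (bd : ∀ i : {i : Pl L // i ∉ S}, HeckeQs L i.1 → ℝ) (σ : ∀ i : {i : Pl L // i ∉ S}, HeckeQs L i.1 → HeckeQs L i.1) (hσ : ∀ i, σ i 1 = 1)
    (hRepGerm : haveI := 𝔣.toS10FrozenDatum.𝔤.hμG; ∀ c : DiscreteClass (G3 L) 𝔣.toS10FrozenDatum.𝔤.μG,
      (∀ i x, ‖germOfDiscreteClass S c i x‖ ≤ bd i x) ∧ ∀ i x, germOfDiscreteClass S c i (σ i x) = (starRingEnd ℂ) (germOfDiscreteClass S c i x))
    {TH : Type*} (𝔖 : StabilisationData (GlobalTestFunction L 3 (qsForm L)) TH) (ΦHu : UnrQs L S → (HLoc L v → ℂ) → TH)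
    (dG : GlobalTestFunction L 3 (qsForm L) → ℂ)
    (cH : {t : Ch13Sec6.EigenvaluePackage S (HeckeQs L) // (∀ i x, ‖t i x‖ ≤ bd i x) ∧ ∀ i x, t i (σ i x) = (starRingEnd ℂ) (t i x)} → (HLoc L v → ℂ) → ℂ)
    (t₀ : {t : Ch13Sec6.EigenvaluePackage S (HeckeQs L) // (∀ i x, ‖t i x‖ ≤ bd i x) ∧ ∀ i x, t i (σ i x) = (starRingEnd ℂ) (t i x)})
    (hD1 : ∀ (u : UnrQs L S) (fH : HLoc L v → ℂ) (φ : Gqs L v → ℂ), MatchE1 L μ v mHv mQv fH φ →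
      𝔖.θG (𝔣.toS10FrozenDatum.𝔳.ΦGu S u φ) - (1 / 2 : ℂ) * 𝔖.SθH (ΦHu u fH) = 0)
    (hθ : ∀ (u : UnrQs L S) (φ : Gqs L v → ℂ), 𝔖.θG (𝔣.toS10FrozenDatum.𝔳.ΦGu S u φ) =
      dG (𝔣.toS10FrozenDatum.𝔳.ΦGu S u φ) + (0 : GlobalTestFunction L 3 (qsForm L) → ℂ) (𝔣.toS10FrozenDatum.𝔳.ΦGu S u φ))
    (hd : haveI := 𝔣.toS10FrozenDatum.𝔤.hμG; haveI := 𝔣.toS10FrozenDatum.𝔤.hνG;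
      ∀ (u : UnrQs L S) (fH : HLoc L v → ℂ) (φ : Gqs L v → ℂ), MatchE1 L μ v mHv mQv fH φ →
      (Summable fun t : {t : Ch13Sec6.EigenvaluePackage S (HeckeQs L) // (∀ i x, ‖t i x‖ ≤ bd i x) ∧ ∀ i x, t i (σ i x) = (starRingEnd ℂ) (t i x)} =>
        cDOf 𝔣.toS10FrozenDatum S (fun c => (⟨germOfDiscreteClass S c, hRepGerm c⟩ : {t : Ch13Sec6.EigenvaluePackage S (HeckeQs L) // (∀ i x, ‖t i x‖ ≤ bd i x) ∧ ∀ i x, t i (σ i x) = (starRingEnd ℂ) (t i x)})) t φ * t.1.hat u.1) ∧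
      dG (𝔣.toS10FrozenDatum.𝔳.ΦGu S u φ) = ∑' t : {t : Ch13Sec6.EigenvaluePackage S (HeckeQs L) // (∀ i x, ‖t i x‖ ≤ bd i x) ∧ ∀ i x, t i (σ i x) = (starRingEnd ℂ) (t i x)},
        cDOf 𝔣.toS10FrozenDatum S (fun c => (⟨germOfDiscreteClass S c, hRepGerm c⟩ : {t : Ch13Sec6.EigenvaluePackage S (HeckeQs L) // (∀ i x, ‖t i x‖ ≤ bd i x) ∧ ∀ i x, t i (σ i x) = (starRingEnd ℂ) (t i x)})) t φ * t.1.hat u.1)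
    (hH : ∀ (u : UnrQs L S) (fH : HLoc L v → ℂ) (φ : Gqs L v → ℂ), MatchE1 L μ v mHv mQv fH φ →
      (Summable fun t : {t : Ch13Sec6.EigenvaluePackage S (HeckeQs L) // (∀ i x, ‖t i x‖ ≤ bd i x) ∧ ∀ i x, t i (σ i x) = (starRingEnd ℂ) (t i x)} =>
        cH t fH * t.1.hat u.1) ∧
      𝔖.SθH (ΦHu u fH) = ∑' t : {t : Ch13Sec6.EigenvaluePackage S (HeckeQs L) // (∀ i x, ‖t i x‖ ≤ bd i x) ∧ ∀ i x, t i (σ i x) = (starRingEnd ℂ) (t i x)},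
        cH t fH * t.1.hat u.1)
    (hH4 : haveI := 𝔣.toS10FrozenDatum.𝔥.hμH; haveI := 𝔣.toS10FrozenDatum.𝔥.hνH;
      ∀ (fH : HLoc L v → ℂ) (φ : Gqs L v → ℂ), MatchE1 L μ v mHv mQv fH φ →
      cH t₀ fH = ∑ᶠ j, (((𝔣.toS10FrozenDatum.𝔥.dρ j).mult).toNat : ℂ) * (𝔣.toS10FrozenDatum.𝔥.dρ j).classTrace 𝔣.toS10FrozenDatum.𝔥.νH (𝔣.toS10FrozenDatum.𝔳.ΦH fH))
    (hbc : ∀ (w : {w : Pl L // w ≠ v}) (hwS : w.1 ∉ S) (πw : IrrClass (Gqs L w.1)) (hadm : πw.IsAdmissible) (hsph : πw.IsSpherical (cmLocalIntegralLevel L 3 (qsForm L) w.1)),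
      LiesOver L μ w.1 (𝔣.toS10FrozenDatum.𝔳.K w.1) (𝔣.toS10FrozenDatum.𝔥.KH w.1) (𝔣.toS10FrozenDatum.𝔳.νQ w) (𝔣.toS10FrozenDatum.𝔳.νHw w)
        (𝔣.toS10FrozenDatum.𝔳.mH w) (𝔣.toS10FrozenDatum.𝔳.mQ w) πw (𝔣.toS10FrozenDatum.𝔥.ρ w.1) →
        unopClassSphericalCharacter (cmLocalIntegralLevel L 3 (qsForm L) w.1) πw hsph = t₀.1 ⟨w.1, hwS⟩)
    (hex : ∀ (w : {w : Pl L // w ≠ v}) (hwS : w.1 ∉ S), ∃ π₀ : IrrClass (Gqs L w.1), π₀.IsAdmissible ∧ ∃ h₀ : π₀.IsSpherical (cmLocalIntegralLevel L 3 (qsForm L) w.1),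
      unopClassSphericalCharacter (cmLocalIntegralLevel L 3 (qsForm L) w.1) π₀ h₀ = t₀.1 ⟨w.1, hwS⟩ ∧
        LiesOver L μ w.1 (𝔣.toS10FrozenDatum.𝔳.K w.1) (𝔣.toS10FrozenDatum.𝔥.KH w.1) (𝔣.toS10FrozenDatum.𝔳.νQ w) (𝔣.toS10FrozenDatum.𝔳.νHw w)
          (𝔣.toS10FrozenDatum.𝔳.mH w) (𝔣.toS10FrozenDatum.𝔳.mQ w) π₀ (𝔣.toS10FrozenDatum.𝔥.ρ w.1)) :
    haveI := 𝔣.toS10FrozenDatum.𝔤.hμG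
    haveI := 𝔣.toS10FrozenDatum.𝔤.hνG
    haveI := 𝔣.toS10FrozenDatum.𝔥.hμH
    haveI := 𝔣.toS10FrozenDatum.𝔥.hνH
    ∀ (fH : HLoc L v → ℂ) (φ : Gqs L v → ℂ), MatchE1 L μ v mHv mQv fH φ →
      ∑ᶠ i : 𝔣.toS10FrozenDatum.𝔤.ι, ((((DiscreteClass.mk (𝔣.toS10FrozenDatum.𝔤.P i)).mult).toNat : ℕ) : ℂ) *
          (DiscreteClass.mk (𝔣.toS10FrozenDatum.𝔤.P i)).classTrace 𝔣.toS10FrozenDatum.𝔤.νG (𝔣.toS10FrozenDatum.𝔳.ΦG φ) =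
        (1 / 2 : ℂ) * ∑ᶠ j, (((𝔣.toS10FrozenDatum.𝔥.dρ j).mult).toNat : ℂ) *
          (𝔣.toS10FrozenDatum.𝔥.dρ j).classTrace 𝔣.toS10FrozenDatum.𝔥.νH (𝔣.toS10FrozenDatum.𝔳.ΦH fH) := by
  -- §1 at the projection `𝔣.toS10FrozenDatum`; the seven by-value inputs are fed as goals (first-order, instant)
  refine stabilisedAtEvp_of_inputs_adm hunr 𝔣.toS10FrozenDatum
    (@R90.S5.automorphicFlathAdmissible_qs_of_residualCompactR L _ _ _ 𝔣.toS10FrozenDatum.𝔤.μG 𝔣.toS10FrozenDatum.𝔤.hμG h12) S hv hS bd σ hσ hRepGerm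
    𝔖 ΦHu dG cH t₀ ?_ ?_ ?_ ?_ ?_ ?_ ?_
  exacts [hD1, hθ, hd, hH, hH4, hbc, hex]

/-! ## §3 (hadm-form) The same keystone with a `t₀`-FREE row-6 binder: existence of a spherical class lying over `ρ_w` (the pin `hbc` realigns it to `t₀`) -/

/-- **THE S10 KEYSTONE, ROW 6 `t₀`-FREE** — `sock₂Sig_of_inputs` with its last binder WEAKENED from the pinned family `hex` («∃ admissible spherical `π₀` of character `(t₀)_w` lying
over `ρ_w`») to the bare existence letter `hLO` («at every `w ≠ v` SOME admissible `U(Φ₃)(𝒪_w)`-spherical class lies over `ρ_w`» — ★ p01 `exists_liesOver_frozen_of_letters` with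
its parameter `tw` forgotten, or K2Liu-p13's level-trace road (H1♭) from `hPS♭`): the pin `hbc` («every spherical class lying over `ρ_w` has character `(t₀)_w`») REALIGNS any such
`π₀` to the named germ `t₀`, so `hex` is recovered inside and §2 applies.  Use this head when `t₀` is NAMED by its payer (S5's `ξ_H`-image) rather than CHOSEN from p01's `∃ t₀`.
[cite: Rogawski1990, §13.8 p. 219 L2–L3; §13.6 Props. 13.6.1–13.6.2 pp. 209–210; §4.9 Prop. 4.9.1 (b) p. 55] [cite: CartierCorvallis1979, §IV.1 Cor. 4.1–4.2] -/
theorem sock₂Sig_of_inputs_of_liesOver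
    (hunr : ∀ w : Pl L, w ≠ v → ∀ W : PlacesOver L w, Algebra.IsUnramifiedAt (𝓞 ↥(maximalRealSubfield L)) W.1.asIdeal ∧ μ.IsUnramifiedAt W.1)
    (𝔣 : S10FrozenDatum₂ L μ v νHv νQv mHv mQv πSt CuspG CuspH)
    (h12 : @K2E1CuspidalSpectrumUnitary.CmResidualSpectrumCompactR L _ _ _ 3 𝔣.toS10FrozenDatum.𝔤.μG 𝔣.toS10FrozenDatum.𝔤.hμG)
    (S : Set (Pl L)) (hv : v ∈ S) (hS : ∀ w, w ∈ S → w = v)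
    (bd : ∀ i : {i : Pl L // i ∉ S}, HeckeQs L i.1 → ℝ) (σ : ∀ i : {i : Pl L // i ∉ S}, HeckeQs L i.1 → HeckeQs L i.1) (hσ : ∀ i, σ i 1 = 1)
    (hRepGerm : haveI := 𝔣.toS10FrozenDatum.𝔤.hμG; ∀ c : DiscreteClass (G3 L) 𝔣.toS10FrozenDatum.𝔤.μG,
      (∀ i x, ‖germOfDiscreteClass S c i x‖ ≤ bd i x) ∧ ∀ i x, germOfDiscreteClass S c i (σ i x) = (starRingEnd ℂ) (germOfDiscreteClass S c i x))
    {TH : Type*} (𝔖 : StabilisationData (GlobalTestFunction L 3 (qsForm L)) TH) (ΦHu : UnrQs L S → (HLoc L v → ℂ) → TH)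
    (dG : GlobalTestFunction L 3 (qsForm L) → ℂ)
    (cH : {t : Ch13Sec6.EigenvaluePackage S (HeckeQs L) // (∀ i x, ‖t i x‖ ≤ bd i x) ∧ ∀ i x, t i (σ i x) = (starRingEnd ℂ) (t i x)} → (HLoc L v → ℂ) → ℂ)
    (t₀ : {t : Ch13Sec6.EigenvaluePackage S (HeckeQs L) // (∀ i x, ‖t i x‖ ≤ bd i x) ∧ ∀ i x, t i (σ i x) = (starRingEnd ℂ) (t i x)})
    (hD1 : ∀ (u : UnrQs L S) (fH : HLoc L v → ℂ) (φ : Gqs L v → ℂ), MatchE1 L μ v mHv mQv fH φ →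
      𝔖.θG (𝔣.toS10FrozenDatum.𝔳.ΦGu S u φ) - (1 / 2 : ℂ) * 𝔖.SθH (ΦHu u fH) = 0)
    (hθ : ∀ (u : UnrQs L S) (φ : Gqs L v → ℂ), 𝔖.θG (𝔣.toS10FrozenDatum.𝔳.ΦGu S u φ) =
      dG (𝔣.toS10FrozenDatum.𝔳.ΦGu S u φ) + (0 : GlobalTestFunction L 3 (qsForm L) → ℂ) (𝔣.toS10FrozenDatum.𝔳.ΦGu S u φ))
    (hd : haveI := 𝔣.toS10FrozenDatum.𝔤.hμG; haveI := 𝔣.toS10FrozenDatum.𝔤.hνG;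
      ∀ (u : UnrQs L S) (fH : HLoc L v → ℂ) (φ : Gqs L v → ℂ), MatchE1 L μ v mHv mQv fH φ →
      (Summable fun t : {t : Ch13Sec6.EigenvaluePackage S (HeckeQs L) // (∀ i x, ‖t i x‖ ≤ bd i x) ∧ ∀ i x, t i (σ i x) = (starRingEnd ℂ) (t i x)} =>
        cDOf 𝔣.toS10FrozenDatum S (fun c => (⟨germOfDiscreteClass S c, hRepGerm c⟩ : {t : Ch13Sec6.EigenvaluePackage S (HeckeQs L) // (∀ i x, ‖t i x‖ ≤ bd i x) ∧ ∀ i x, t i (σ i x) = (starRingEnd ℂ) (t i x)})) t φ * t.1.hat u.1) ∧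
      dG (𝔣.toS10FrozenDatum.𝔳.ΦGu S u φ) = ∑' t : {t : Ch13Sec6.EigenvaluePackage S (HeckeQs L) // (∀ i x, ‖t i x‖ ≤ bd i x) ∧ ∀ i x, t i (σ i x) = (starRingEnd ℂ) (t i x)},
        cDOf 𝔣.toS10FrozenDatum S (fun c => (⟨germOfDiscreteClass S c, hRepGerm c⟩ : {t : Ch13Sec6.EigenvaluePackage S (HeckeQs L) // (∀ i x, ‖t i x‖ ≤ bd i x) ∧ ∀ i x, t i (σ i x) = (starRingEnd ℂ) (t i x)})) t φ * t.1.hat u.1)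
    (hH : ∀ (u : UnrQs L S) (fH : HLoc L v → ℂ) (φ : Gqs L v → ℂ), MatchE1 L μ v mHv mQv fH φ →
      (Summable fun t : {t : Ch13Sec6.EigenvaluePackage S (HeckeQs L) // (∀ i x, ‖t i x‖ ≤ bd i x) ∧ ∀ i x, t i (σ i x) = (starRingEnd ℂ) (t i x)} =>
        cH t fH * t.1.hat u.1) ∧
      𝔖.SθH (ΦHu u fH) = ∑' t : {t : Ch13Sec6.EigenvaluePackage S (HeckeQs L) // (∀ i x, ‖t i x‖ ≤ bd i x) ∧ ∀ i x, t i (σ i x) = (starRingEnd ℂ) (t i x)},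
        cH t fH * t.1.hat u.1)
    (hH4 : haveI := 𝔣.toS10FrozenDatum.𝔥.hμH; haveI := 𝔣.toS10FrozenDatum.𝔥.hνH;
      ∀ (fH : HLoc L v → ℂ) (φ : Gqs L v → ℂ), MatchE1 L μ v mHv mQv fH φ →
      cH t₀ fH = ∑ᶠ j, (((𝔣.toS10FrozenDatum.𝔥.dρ j).mult).toNat : ℂ) * (𝔣.toS10FrozenDatum.𝔥.dρ j).classTrace 𝔣.toS10FrozenDatum.𝔥.νH (𝔣.toS10FrozenDatum.𝔳.ΦH fH))
    (hbc : ∀ (w : {w : Pl L // w ≠ v}) (hwS : w.1 ∉ S) (πw : IrrClass (Gqs L w.1)) (hadm : πw.IsAdmissible) (hsph : πw.IsSpherical (cmLocalIntegralLevel L 3 (qsForm L) w.1)),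
      LiesOver L μ w.1 (𝔣.toS10FrozenDatum.𝔳.K w.1) (𝔣.toS10FrozenDatum.𝔥.KH w.1) (𝔣.toS10FrozenDatum.𝔳.νQ w) (𝔣.toS10FrozenDatum.𝔳.νHw w)
        (𝔣.toS10FrozenDatum.𝔳.mH w) (𝔣.toS10FrozenDatum.𝔳.mQ w) πw (𝔣.toS10FrozenDatum.𝔥.ρ w.1) →
        unopClassSphericalCharacter (cmLocalIntegralLevel L 3 (qsForm L) w.1) πw hsph = t₀.1 ⟨w.1, hwS⟩)
    (hLO : ∀ w : {w : Pl L // w ≠ v}, ∃ π₀ : IrrClass (Gqs L w.1), π₀.IsAdmissible ∧ π₀.IsSpherical (cmLocalIntegralLevel L 3 (qsForm L) w.1) ∧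
      LiesOver L μ w.1 (𝔣.toS10FrozenDatum.𝔳.K w.1) (𝔣.toS10FrozenDatum.𝔥.KH w.1) (𝔣.toS10FrozenDatum.𝔳.νQ w) (𝔣.toS10FrozenDatum.𝔳.νHw w)
        (𝔣.toS10FrozenDatum.𝔳.mH w) (𝔣.toS10FrozenDatum.𝔳.mQ w) π₀ (𝔣.toS10FrozenDatum.𝔥.ρ w.1)) :
    haveI := 𝔣.toS10FrozenDatum.𝔤.hμG
    haveI := 𝔣.toS10FrozenDatum.𝔤.hνG
    haveI := 𝔣.toS10FrozenDatum.𝔥.hμH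
    haveI := 𝔣.toS10FrozenDatum.𝔥.hνH
    ∀ (fH : HLoc L v → ℂ) (φ : Gqs L v → ℂ), MatchE1 L μ v mHv mQv fH φ →
      ∑ᶠ i : 𝔣.toS10FrozenDatum.𝔤.ι, ((((DiscreteClass.mk (𝔣.toS10FrozenDatum.𝔤.P i)).mult).toNat : ℕ) : ℂ) *
          (DiscreteClass.mk (𝔣.toS10FrozenDatum.𝔤.P i)).classTrace 𝔣.toS10FrozenDatum.𝔤.νG (𝔣.toS10FrozenDatum.𝔳.ΦG φ) =
        (1 / 2 : ℂ) * ∑ᶠ j, (((𝔣.toS10FrozenDatum.𝔥.dρ j).mult).toNat : ℂ) *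
          (𝔣.toS10FrozenDatum.𝔥.dρ j).classTrace 𝔣.toS10FrozenDatum.𝔥.νH (𝔣.toS10FrozenDatum.𝔳.ΦH fH) := by
  -- row 6's pinned family `hex` at the NAMED `t₀`: the pin `hbc` realigns the character of any spherical class lying over `ρ_w`
  have hex : ∀ (w : {w : Pl L // w ≠ v}) (hwS : w.1 ∉ S), ∃ π₀ : IrrClass (Gqs L w.1), π₀.IsAdmissible ∧ ∃ h₀ : π₀.IsSpherical (cmLocalIntegralLevel L 3 (qsForm L) w.1),
      unopClassSphericalCharacter (cmLocalIntegralLevel L 3 (qsForm L) w.1) π₀ h₀ = t₀.1 ⟨w.1, hwS⟩ ∧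
        LiesOver L μ w.1 (𝔣.toS10FrozenDatum.𝔳.K w.1) (𝔣.toS10FrozenDatum.𝔥.KH w.1) (𝔣.toS10FrozenDatum.𝔳.νQ w) (𝔣.toS10FrozenDatum.𝔳.νHw w)
          (𝔣.toS10FrozenDatum.𝔳.mH w) (𝔣.toS10FrozenDatum.𝔳.mQ w) π₀ (𝔣.toS10FrozenDatum.𝔥.ρ w.1) := fun w hwS => by
    obtain ⟨π₀, hadm, h₀, hLOw⟩ := hLO w
    exact ⟨π₀, hadm, h₀, hbc w hwS π₀ hadm h₀ hLOw, hLOw⟩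
  refine sock₂Sig_of_inputs_adm hunr 𝔣 h12 S hv hS bd σ hσ hRepGerm 𝔖 ΦHu dG cH t₀ ?_ ?_ ?_ ?_ ?_ ?_ hex
  exacts [hD1, hθ, hd, hH, hH4, hbc]

end KeystoneAdm

end Summit.HodgeConjecture.HodgeConjecture.R90.S10

end
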